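import HarnessLib.Audit.Tags
import Literature.NumberTheory.Sieve.PolynomialCongruences
import Summits.Parity.BatemanHorn.Theses.LambertRoots

/-!
# Crux `MuRootWeyl` (stmt-Parity-16279; route `LambertRoots`, rank 4) — BIRTH SKELETON `Lines/birth.lean` (BC3)

planner-skel-stmt-Parity-16279-0 (skeleton registrar, one-shot; route re-audit bin REPAIRABLE), 2026-08-17.
Target: the route decl `Summit.Parity.BatemanHorn.Theses.LambertRoots.MuRootWeyl` BY NAME (rev 4 of the route
file), concluded by `MuRootWeyl_of` from four named stubs (the only `sorry`s of the file); the hypothesis form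
`stub₁-sig → stub₂-sig → stub₃-sig → stub₄-sig → MuRootWeyl` is the kernel-checked `example` next to it, and the
converse `MuRootWeyl → (each stub)` is certified sorry-free at the end (`single_of_muRootWeyl`,
`system_of_muRootWeyl`): the split is EXACT — the crux is equivalent to the conjunction of the four stubs.

## The crux (fixed; not restated)

For every Bateman–Horn system `f = (f₁,…,f_k)` and all `A, B > 0` there are `C, D₀` with, for `D ≥ D₀` and
`0 < |j| ≤ (log D)^B`,
`|Σ_{d ∈ [1,D]^k, L = lcm d ≤ D} ∏ᵢ μ(dᵢ) log dᵢ · Σ_{0 ≤ ν < L, dᵢ ∣ fᵢ(ν) ∀ i} e(jν/L)| ≤ C·D/(log D)^A`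
— log-power Möbius cancellation in the modulus of the Weyl sums of the JOINT roots; no equidistribution is
asserted (false for linear members).

## The line: cut by arithmetic regime (the route's own TWO-LAYER PLAN `MuRootWeylLinear → MuRootWeylCRT`)

The modulus-side harmonic analysis behind the crux lives in three different theories according to the shape
of the system, and the skeleton cuts exactly there:

* ONE polynomial (`k = 1`): the joint-root Weyl sum is `Literature.NumberTheory.Sieve.polyRootWeylSum g d j`
  (the k = 1 re-indexing `tupleSum_fin_one` below is PROVED), and the claim is
  `Σ_{d ≤ D} μ(d) log d · S_g(j; d) ≪_A D/(log D)^A` for `0 < |j| ≤ (log D)^B`, split by degree: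
  - `stub_linear` (`deg g ≤ 1`; PROVABLE NOW, M): `g = aX + b` primitive, `S_g(j; d) = e(−jb·ā/d)·[(d,a)=1]`;
    reciprocity `ā/d + đ/a ≡ 1/(ad) (mod 1)` turns the sum into `Σ_{r ∈ (ℤ/a)ˣ} e(jb·r̄/a) Σ_{d ≡ r (a)}
    μ(d) log d · e(−jb/(ad))` — the prime number theorem for `μ` in progressions to the FIXED modulus `a`
    with log-power error, plus partial summation against the smooth phase `e(−jb/(ad))` (derivative
    `≪ |jb|/(a d²)`); degree 0 is vacuous (a prime constant has a fixed prime divisor).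
  - `stub_quadratic` (`deg g = 2`; L, STRONGER THAN PRINT): the Duke–Friedlander–Iwaniec (Δ < 0) /
    Tóth (Δ > 0) technology — linear forms over multiples and bilinear forms in `ρ_h(mn)` — gives the
    Λ-weighted prime-moduli sums `o(π(x))`, Homma's rate `(log x)^{-2}(log log x)^{19}` (tree fact
    `Literature.NumberTheory.Sieve.homma2008_lemma2`); an ARBITRARY log-power `A` with `μ·log` weights over
    all moduli is not in print (Type-II information only in a narrow range) — this is the slice the crux
    ideas attached to stmt-Parity-16279 as evidence (balanced-loglog-residual, window-is-root-fractions,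
    dfi-prop4-moebius-sieve, polylog-gm-sieve-budget, dfi-sieve-below-cube-root-gap) price; the sixth,
    crt-bilinear-bdh, addresses the system slice `stub_system` below.
  - `stub_higher` (`deg g ≥ 3`; open): only Hooley's UNtwisted `Σ_{d ≤ D} S_g(h; d) = o(D)` with a
    `(log D)^{-δ}` saving is known (`Literature.NumberTheory.Sieve.hooley_polyRoots_equidistributed`);
    μ-twisted log-power cancellation is open (Kowalski–Soundararajan 2021: even prime-moduli
    equidistribution is open in degree ≥ 3).
* SYSTEMS (`k ≥ 2`): `stub_system` (L/XL): by CRT the joint root class `ν mod L` of a tuple with coprime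
  coordinates splits as `ν/L ≡ Σᵢ νᵢ·\overline{(L/dᵢ)}/dᵢ (mod 1)`, so `e(jν/L)` is a product of
  ROOT-TWISTED KLOOSTERMAN FRACTIONS `e(j νᵢ \overline{(L/dᵢ)}/dᵢ)`; tuples sharing a prime between two
  coordinates live on the finitely many `p ∣ Res(fᵢ, fᵢ')`. The sum is multilinear in `(d₁,…,d_k)` over the
  hyperbolic region `lcm ≤ D` with coefficients `μ log ⊗ … ⊗ μ log`: unbalanced ranges = the k = 1 sums in
  progressions to moduli `≤ (log D)^{B'}` (Siegel–Walfisz-type uniformity), balanced ranges = bilinear forms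
  with Kloosterman fractions (Duke–Friedlander–Iwaniec 1997) twisted by roots. For the twin system
  `(X, X+2)` it is literally `ΣΣ_{d₁d₂ ≤ D, (d₁,d₂)=1} μ(d₁)log d₁ μ(d₂)log d₂ e(−2j·d̄₁/d₂)` (DFI 1997 +
  Siegel–Walfisz, in print modulo porting); with a member of degree ≥ 2 it inherits the k = 1 difficulty.

`MuRootWeyl_of` assembles: `k = 0` (the empty system IS a Bateman–Horn system; its tuple sum is the single
term `1`, and `1 ≤ D/(log D)^A` for large `D` — PROVED below, `emptySystem_bound`), `k = 1` (trichotomy on the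
degree + the proved re-indexing `tupleSum_fin_one` + `![f 0] = f`), `k ≥ 2` (`stub_system`).

Disproof used: none relevant — no `Disproof.lean` and no `Negative/` lemma exist for this crux as of 2026-08-17
(`ledger crux ls stmt-Parity-16279`: no workfiles); `ledger negatives --problem Parity` has no statement about
root Weyl sums twisted by `μ`. Dead lines: none recorded for this crux.
-/

namespace Summit.Parity.BatemanHorn.Cruxes.MuRootWeyl.Birth

open Filter

/-! ### Registered stubs (the only `sorry`s of the line) -/

/-- stub (LINEAR MEMBERS, `k = 1`, `deg g ≤ 1` — provable now): for `g = aX + b` a Bateman–Horn system on its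
own (primitive, `a > 0`) and all `A, B > 0`: `|Σ_{d ≤ D} μ(d) log d · S_g(j; d)| ≤ C·D/(log D)^A` for
`D ≥ D₀`, `0 < |j| ≤ (log D)^B`. PNT for `μ` in progressions mod `a` + reciprocity + partial summation;
degree `0` is vacuous. -/
theorem stub_linear :
    ∀ g : Polynomial ℤ, Literature.NumberTheory.Sieve.IsBatemanHornSystem ![g] → g.natDegree ≤ 1 →
    ∀ A B : ℝ, 0 < A → 0 < B → ∃ C : ℝ, ∃ D₀ : ℕ, ∀ D : ℕ, D₀ ≤ D → ∀ j : ℤ, j ≠ 0 →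
      (|j| : ℝ) ≤ Real.log D ^ B →
      ‖∑ d ∈ Finset.Icc 1 D, (((ArithmeticFunction.moebius d : ℝ) * Real.log d : ℝ) : ℂ) *
          Literature.NumberTheory.Sieve.polyRootWeylSum g d j‖ ≤ C * (D : ℝ) / Real.log D ^ A := by
  sorry

/-- stub (ONE QUADRATIC, `k = 1`, `deg g = 2` — Duke–Friedlander–Iwaniec / Tóth / Homma grade, log-power
saving `A` and `μ·log` weights over ALL moduli: stronger than print): for an irreducible quadratic `g` forming a
Bateman–Horn system and all `A, B > 0`: `|Σ_{d ≤ D} μ(d) log d · S_g(j; d)| ≤ C·D/(log D)^A` for `D ≥ D₀`,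
`0 < |j| ≤ (log D)^B`. -/
theorem stub_quadratic :
    ∀ g : Polynomial ℤ, Literature.NumberTheory.Sieve.IsBatemanHornSystem ![g] → g.natDegree = 2 →
    ∀ A B : ℝ, 0 < A → 0 < B → ∃ C : ℝ, ∃ D₀ : ℕ, ∀ D : ℕ, D₀ ≤ D → ∀ j : ℤ, j ≠ 0 →
      (|j| : ℝ) ≤ Real.log D ^ B →
      ‖∑ d ∈ Finset.Icc 1 D, (((ArithmeticFunction.moebius d : ℝ) * Real.log d : ℝ) : ℂ) *
          Literature.NumberTheory.Sieve.polyRootWeylSum g d j‖ ≤ C * (D : ℝ) / Real.log D ^ A := by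
  sorry

/-- stub (ONE POLYNOMIAL OF DEGREE ≥ 3, `k = 1` — open; Hooley's untwisted `(log D)^{-δ}` is all that is in
print): for an irreducible `g` of degree `≥ 3` forming a Bateman–Horn system and all `A, B > 0`:
`|Σ_{d ≤ D} μ(d) log d · S_g(j; d)| ≤ C·D/(log D)^A` for `D ≥ D₀`, `0 < |j| ≤ (log D)^B`. -/
theorem stub_higher :
    ∀ g : Polynomial ℤ, Literature.NumberTheory.Sieve.IsBatemanHornSystem ![g] → 3 ≤ g.natDegree →
    ∀ A B : ℝ, 0 < A → 0 < B → ∃ C : ℝ, ∃ D₀ : ℕ, ∀ D : ℕ, D₀ ≤ D → ∀ j : ℤ, j ≠ 0 →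
      (|j| : ℝ) ≤ Real.log D ^ B →
      ‖∑ d ∈ Finset.Icc 1 D, (((ArithmeticFunction.moebius d : ℝ) * Real.log d : ℝ) : ℂ) *
          Literature.NumberTheory.Sieve.polyRootWeylSum g d j‖ ≤ C * (D : ℝ) / Real.log D ^ A := by
  sorry

/-- stub (SYSTEMS, `k ≥ 2` — CRT / root-twisted Kloosterman fractions, Duke–Friedlander–Iwaniec 1997 +
Siegel–Walfisz in the unbalanced ranges): the crux's bound for every Bateman–Horn system of at least two
polynomials (the tuple sum verbatim). -/
theorem stub_system :
    ∀ (k : ℕ) (f : Fin k → Polynomial ℤ), Literature.NumberTheory.Sieve.IsBatemanHornSystem f → 2 ≤ k →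
    ∀ A B : ℝ, 0 < A → 0 < B → ∃ C : ℝ, ∃ D₀ : ℕ, ∀ D : ℕ, D₀ ≤ D → ∀ j : ℤ, j ≠ 0 →
      (|j| : ℝ) ≤ Real.log D ^ B →
      ‖∑ d ∈ (Fintype.piFinset fun _ : Fin k => Finset.Icc 1 D).filter (fun d => Finset.univ.lcm d ≤ D),
          ((∏ i, ((ArithmeticFunction.moebius (d i) : ℝ) * Real.log (d i)) : ℝ) : ℂ) *
          ∑ ν ∈ (Finset.range (Finset.univ.lcm d)).filter
              (fun ν : ℕ => ∀ i, ((d i : ℕ) : ℤ) ∣ (f i).eval (ν : ℤ)),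
            Complex.exp (2 * Real.pi * Complex.I * ((j : ℂ) * (ν : ℂ) / ((Finset.univ.lcm d : ℕ) : ℂ)))‖
        ≤ C * (D : ℝ) / Real.log D ^ A := by
  sorry

/-! ### Proved bookkeeping: `k = 1` re-indexing and the empty system -/

/-- For `d : Fin 1 → ℕ` the lcm over all coordinates is `d 0`. [folklore] -/
theorem lcm_fin_one (d : Fin 1 → ℕ) : Finset.univ.lcm d = d 0 := by
  rw [Finset.univ_unique, Fin.default_eq_zero, Finset.lcm_singleton, normalize_eq]

/-- `k = 1` RE-INDEXING (proved): the route's tuple sum over `d : Fin 1 → ℕ` with `lcm d ≤ D` is the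
single-modulus sum `Σ_{d ≤ D} μ(d) log d · S_{g 0}(j; d)` written with
`Literature.NumberTheory.Sieve.polyRootWeylSum`. [folklore] -/
theorem tupleSum_fin_one (g : Fin 1 → Polynomial ℤ) (D : ℕ) (j : ℤ) :
    (∑ d ∈ (Fintype.piFinset fun _ : Fin 1 => Finset.Icc 1 D).filter (fun d => Finset.univ.lcm d ≤ D),
        ((∏ i, ((ArithmeticFunction.moebius (d i) : ℝ) * Real.log (d i)) : ℝ) : ℂ) *
        ∑ ν ∈ (Finset.range (Finset.univ.lcm d)).filter
            (fun ν : ℕ => ∀ i, ((d i : ℕ) : ℤ) ∣ (g i).eval (ν : ℤ)),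
          Complex.exp (2 * Real.pi * Complex.I * ((j : ℂ) * (ν : ℂ) / ((Finset.univ.lcm d : ℕ) : ℂ))))
      = ∑ d ∈ Finset.Icc 1 D, (((ArithmeticFunction.moebius d : ℝ) * Real.log d : ℝ) : ℂ) *
          Literature.NumberTheory.Sieve.polyRootWeylSum (g 0) d j := by
  refine Finset.sum_nbij' (fun d => d 0) (fun n _ => n) ?_ ?_ ?_ ?_ ?_
  · intro d hd
    simp only [Finset.mem_filter, Fintype.mem_piFinset] at hd
    exact hd.1 0
  · intro n hn
    simp only [Finset.mem_filter, Fintype.mem_piFinset]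
    refine ⟨fun _ => hn, ?_⟩
    rw [lcm_fin_one]
    exact (Finset.mem_Icc.1 hn).2
  · intro d _
    funext i
    rw [Fin.fin_one_eq_zero i]
  · intro n _
    rfl
  · intro d _
    rw [Fin.prod_univ_one, Literature.NumberTheory.Sieve.polyRootWeylSum_def, lcm_fin_one]
    congr 1
    refine Finset.sum_congr ?_ (fun ν _ => rfl)
    ext ν
    simp only [Finset.mem_filter, Fin.forall_fin_one]

/-- A one-element system, as a `Fin 1`-vector, is `![f 0]`. [folklore] -/
theorem vec_fin_one (f : Fin 1 → Polynomial ℤ) : (![f 0] : Fin 1 → Polynomial ℤ) = f := by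
  funext i
  rw [Fin.fin_one_eq_zero i]
  rfl

/-- `k = 0` (PROVED): for the EMPTY system the tuple sum is the single term `1·e(0) = 1` (`lcm ∅ = 1`), so the
crux's bound holds with `C = 1` as soon as `(log D)^A ≤ D` and `D ≥ 2`. [folklore] -/
theorem emptySystem_bound (f : Fin 0 → Polynomial ℤ) (A B : ℝ) :
    ∃ C : ℝ, ∃ D₀ : ℕ, ∀ D : ℕ, D₀ ≤ D → ∀ j : ℤ, j ≠ 0 → (|j| : ℝ) ≤ Real.log D ^ B →
      ‖∑ d ∈ (Fintype.piFinset fun _ : Fin 0 => Finset.Icc 1 D).filter (fun d => Finset.univ.lcm d ≤ D),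
          ((∏ i, ((ArithmeticFunction.moebius (d i) : ℝ) * Real.log (d i)) : ℝ) : ℂ) *
          ∑ ν ∈ (Finset.range (Finset.univ.lcm d)).filter
              (fun ν : ℕ => ∀ i, ((d i : ℕ) : ℤ) ∣ (f i).eval (ν : ℤ)),
            Complex.exp (2 * Real.pi * Complex.I * ((j : ℂ) * (ν : ℂ) / ((Finset.univ.lcm d : ℕ) : ℂ)))‖
        ≤ C * (D : ℝ) / Real.log D ^ A := by
  -- `(log x)^A ≤ x` for real `x ≥ T`
  obtain ⟨T, hTle⟩ : ∃ T : ℝ, ∀ x : ℝ, T ≤ x → Real.log x ^ A ≤ x := by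
    have hlo := (isLittleO_log_rpow_rpow_atTop A one_pos).bound one_pos
    obtain ⟨T, hT'⟩ := Filter.eventually_atTop.mp hlo
    refine ⟨max T 1, fun x hx => ?_⟩
    have hx1 : 1 ≤ x := (le_max_right T 1).trans hx
    have hx0 : 0 < x := by linarith
    have h1 : ‖Real.log x ^ A‖ ≤ 1 * ‖x ^ (1 : ℝ)‖ := hT' x ((le_max_left T 1).trans hx)
    rw [one_mul, Real.rpow_one, Real.norm_eq_abs, Real.norm_eq_abs, abs_of_pos hx0] at h1
    exact (le_abs_self _).trans h1
  refine ⟨1, max ⌈T⌉₊ 2, fun D hD j _ _ => ?_⟩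
  have hD2 : 2 ≤ D := (le_max_right _ _).trans hD
  have hDT : T ≤ (D : ℝ) := (Nat.le_ceil T).trans (by exact_mod_cast (le_max_left _ _).trans hD)
  have hlogpos : 0 < Real.log D := Real.log_pos (by exact_mod_cast hD2)
  have hpow : 0 < Real.log D ^ A := Real.rpow_pos_of_pos hlogpos A
  have hrhs : (1 : ℝ) ≤ 1 * (D : ℝ) / Real.log D ^ A := by
    rw [one_mul, le_div_iff₀ hpow, one_mul]
    exact hTle D hDT
  refine le_trans ?_ hrhs
  -- the tuple sum has at most one term, each term has norm ≤ 1
  have hl0 : ∀ d : Fin 0 → ℕ, Finset.univ.lcm d = 1 := fun d => by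
    rw [Finset.univ_eq_empty, Finset.lcm_empty]
  refine (norm_sum_le _ _).trans ?_
  have hterm : ∀ d ∈ (Fintype.piFinset fun _ : Fin 0 => Finset.Icc 1 D).filter
      (fun d => Finset.univ.lcm d ≤ D),
      ‖((∏ i, ((ArithmeticFunction.moebius (d i) : ℝ) * Real.log (d i)) : ℝ) : ℂ) *
          ∑ ν ∈ (Finset.range (Finset.univ.lcm d)).filter
              (fun ν : ℕ => ∀ i, ((d i : ℕ) : ℤ) ∣ (f i).eval (ν : ℤ)),
            Complex.exp (2 * Real.pi * Complex.I * ((j : ℂ) * (ν : ℂ) / ((Finset.univ.lcm d : ℕ) : ℂ)))‖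
        ≤ 1 := by
    intro d _
    rw [norm_mul]
    have h1 : ‖(((∏ i, ((ArithmeticFunction.moebius (d i) : ℝ) * Real.log (d i)) : ℝ) : ℂ))‖ = 1 := by
      rw [Finset.univ_eq_empty, Finset.prod_empty]
      simp
    have h2 : ‖∑ ν ∈ (Finset.range (Finset.univ.lcm d)).filter
              (fun ν : ℕ => ∀ i, ((d i : ℕ) : ℤ) ∣ (f i).eval (ν : ℤ)),
            Complex.exp (2 * Real.pi * Complex.I * ((j : ℂ) * (ν : ℂ) / ((Finset.univ.lcm d : ℕ) : ℂ)))‖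
        ≤ 1 := by
      refine (norm_sum_le _ _).trans ?_
      have hone : ∀ ν ∈ (Finset.range (Finset.univ.lcm d)).filter
          (fun ν : ℕ => ∀ i, ((d i : ℕ) : ℤ) ∣ (f i).eval (ν : ℤ)),
          ‖Complex.exp (2 * Real.pi * Complex.I * ((j : ℂ) * (ν : ℂ) / ((Finset.univ.lcm d : ℕ) : ℂ)))‖
            ≤ 1 := by
        intro ν _
        rw [show (2 * (Real.pi : ℂ) * Complex.I * ((j : ℂ) * (ν : ℂ) / ((Finset.univ.lcm d : ℕ) : ℂ)))
            = ((2 * Real.pi * ((j : ℝ) * (ν : ℝ) / ((Finset.univ.lcm d : ℕ) : ℝ)) : ℝ) : ℂ) * Complex.I by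
          push_cast; ring]
        rw [Complex.norm_exp_ofReal_mul_I]
      refine (Finset.sum_le_card_nsmul _ _ 1 hone).trans ?_
      rw [nsmul_eq_mul, mul_one]
      have hc : ((Finset.range (Finset.univ.lcm d)).filter
          (fun ν : ℕ => ∀ i, ((d i : ℕ) : ℤ) ∣ (f i).eval (ν : ℤ))).card ≤ 1 := by
        refine (Finset.card_filter_le _ _).trans ?_
        rw [Finset.card_range, hl0]
      exact_mod_cast hc
    calc ‖(((∏ i, ((ArithmeticFunction.moebius (d i) : ℝ) * Real.log (d i)) : ℝ) : ℂ))‖ *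
          ‖∑ ν ∈ (Finset.range (Finset.univ.lcm d)).filter
              (fun ν : ℕ => ∀ i, ((d i : ℕ) : ℤ) ∣ (f i).eval (ν : ℤ)),
            Complex.exp (2 * Real.pi * Complex.I * ((j : ℂ) * (ν : ℂ) / ((Finset.univ.lcm d : ℕ) : ℂ)))‖
        ≤ 1 * 1 := mul_le_mul h1.le h2 (norm_nonneg _) zero_le_one
      _ = 1 := one_mul 1
  refine (Finset.sum_le_card_nsmul _ _ 1 hterm).trans ?_
  rw [nsmul_eq_mul, mul_one]
  have hcard : ((Fintype.piFinset fun _ : Fin 0 => Finset.Icc 1 D).filter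
      (fun d => Finset.univ.lcm d ≤ D)).card ≤ 1 := by
    refine (Finset.card_filter_le _ _).trans ?_
    rw [Fintype.card_piFinset, Finset.univ_eq_empty, Finset.prod_empty]
  exact_mod_cast hcard

/-! ### Assembly -/

/-- ASSEMBLY IN HYPOTHESIS FORM (kernel-checked, sorry-free; an `example`, because the native skeleton audit
admits as hypotheses of a crux-concluding THEOREM only named obligations):
`stub_linear-sig → stub_quadratic-sig → stub_higher-sig → stub_system-sig → MuRootWeyl` — case split on the
number of polynomials (`k = 0` proved outright, `k = 1` by the degree trichotomy and the proved re-indexing,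
`k ≥ 2` the system stub). -/
example
    (hlin : ∀ g : Polynomial ℤ, Literature.NumberTheory.Sieve.IsBatemanHornSystem ![g] → g.natDegree ≤ 1 →
      ∀ A B : ℝ, 0 < A → 0 < B → ∃ C : ℝ, ∃ D₀ : ℕ, ∀ D : ℕ, D₀ ≤ D → ∀ j : ℤ, j ≠ 0 →
      (|j| : ℝ) ≤ Real.log D ^ B →
      ‖∑ d ∈ Finset.Icc 1 D, (((ArithmeticFunction.moebius d : ℝ) * Real.log d : ℝ) : ℂ) *
          Literature.NumberTheory.Sieve.polyRootWeylSum g d j‖ ≤ C * (D : ℝ) / Real.log D ^ A)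
    (hquad : ∀ g : Polynomial ℤ, Literature.NumberTheory.Sieve.IsBatemanHornSystem ![g] → g.natDegree = 2 →
      ∀ A B : ℝ, 0 < A → 0 < B → ∃ C : ℝ, ∃ D₀ : ℕ, ∀ D : ℕ, D₀ ≤ D → ∀ j : ℤ, j ≠ 0 →
      (|j| : ℝ) ≤ Real.log D ^ B →
      ‖∑ d ∈ Finset.Icc 1 D, (((ArithmeticFunction.moebius d : ℝ) * Real.log d : ℝ) : ℂ) *
          Literature.NumberTheory.Sieve.polyRootWeylSum g d j‖ ≤ C * (D : ℝ) / Real.log D ^ A)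
    (hhigh : ∀ g : Polynomial ℤ, Literature.NumberTheory.Sieve.IsBatemanHornSystem ![g] → 3 ≤ g.natDegree →
      ∀ A B : ℝ, 0 < A → 0 < B → ∃ C : ℝ, ∃ D₀ : ℕ, ∀ D : ℕ, D₀ ≤ D → ∀ j : ℤ, j ≠ 0 →
      (|j| : ℝ) ≤ Real.log D ^ B →
      ‖∑ d ∈ Finset.Icc 1 D, (((ArithmeticFunction.moebius d : ℝ) * Real.log d : ℝ) : ℂ) *
          Literature.NumberTheory.Sieve.polyRootWeylSum g d j‖ ≤ C * (D : ℝ) / Real.log D ^ A)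
    (hsys : ∀ (k : ℕ) (f : Fin k → Polynomial ℤ), Literature.NumberTheory.Sieve.IsBatemanHornSystem f →
      2 ≤ k → ∀ A B : ℝ, 0 < A → 0 < B → ∃ C : ℝ, ∃ D₀ : ℕ, ∀ D : ℕ, D₀ ≤ D → ∀ j : ℤ, j ≠ 0 →
      (|j| : ℝ) ≤ Real.log D ^ B →
      ‖∑ d ∈ (Fintype.piFinset fun _ : Fin k => Finset.Icc 1 D).filter (fun d => Finset.univ.lcm d ≤ D),
          ((∏ i, ((ArithmeticFunction.moebius (d i) : ℝ) * Real.log (d i)) : ℝ) : ℂ) *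
          ∑ ν ∈ (Finset.range (Finset.univ.lcm d)).filter
              (fun ν : ℕ => ∀ i, ((d i : ℕ) : ℤ) ∣ (f i).eval (ν : ℤ)),
            Complex.exp (2 * Real.pi * Complex.I * ((j : ℂ) * (ν : ℂ) / ((Finset.univ.lcm d : ℕ) : ℂ)))‖
        ≤ C * (D : ℝ) / Real.log D ^ A) :
    Summit.Parity.BatemanHorn.Theses.LambertRoots.MuRootWeyl := by
  intro k f hf A B hA hB
  obtain rfl | rfl | hk2 : k = 0 ∨ k = 1 ∨ 2 ≤ k := by omega
  · exact emptySystem_bound f A B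
  · have hg : Literature.NumberTheory.Sieve.IsBatemanHornSystem ![f 0] := by rw [vec_fin_one f]; exact hf
    obtain ⟨C, D₀, hC⟩ : ∃ C : ℝ, ∃ D₀ : ℕ, ∀ D : ℕ, D₀ ≤ D → ∀ j : ℤ, j ≠ 0 →
        (|j| : ℝ) ≤ Real.log D ^ B →
        ‖∑ d ∈ Finset.Icc 1 D, (((ArithmeticFunction.moebius d : ℝ) * Real.log d : ℝ) : ℂ) *
            Literature.NumberTheory.Sieve.polyRootWeylSum (f 0) d j‖ ≤ C * (D : ℝ) / Real.log D ^ A := by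
      obtain h | h | h : (f 0).natDegree ≤ 1 ∨ (f 0).natDegree = 2 ∨ 3 ≤ (f 0).natDegree := by omega
      exacts [hlin (f 0) hg h A B hA hB, hquad (f 0) hg h A B hA hB, hhigh (f 0) hg h A B hA hB]
    exact ⟨C, D₀, fun D hD j hj hjB => by rw [tupleSum_fin_one]; exact hC D hD j hj hjB⟩
  · exact hsys k f hf hk2 A B hA hB

/-- THE SKELETON THEOREM (D-0027 §3.3 shape; the composition above with the registered stubs plugged in BY
NAME): the crux `LambertRoots.MuRootWeyl`, concluded by name; no `sorry` here — it becomes the crux proof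
when the four `stub_…` are discharged (`#print axioms` today: the stubs' `sorryAx` plus propext /
Classical.choice / Quot.sound). -/
theorem MuRootWeyl_of : Summit.Parity.BatemanHorn.Theses.LambertRoots.MuRootWeyl := by
  intro k f hf A B hA hB
  obtain rfl | rfl | hk2 : k = 0 ∨ k = 1 ∨ 2 ≤ k := by omega
  · exact emptySystem_bound f A B
  · have hg : Literature.NumberTheory.Sieve.IsBatemanHornSystem ![f 0] := by rw [vec_fin_one f]; exact hf
    obtain ⟨C, D₀, hC⟩ : ∃ C : ℝ, ∃ D₀ : ℕ, ∀ D : ℕ, D₀ ≤ D → ∀ j : ℤ, j ≠ 0 →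
        (|j| : ℝ) ≤ Real.log D ^ B →
        ‖∑ d ∈ Finset.Icc 1 D, (((ArithmeticFunction.moebius d : ℝ) * Real.log d : ℝ) : ℂ) *
            Literature.NumberTheory.Sieve.polyRootWeylSum (f 0) d j‖ ≤ C * (D : ℝ) / Real.log D ^ A := by
      obtain h | h | h : (f 0).natDegree ≤ 1 ∨ (f 0).natDegree = 2 ∨ 3 ≤ (f 0).natDegree := by omega
      exacts [stub_linear (f 0) hg h A B hA hB, stub_quadratic (f 0) hg h A B hA hB,
        stub_higher (f 0) hg h A B hA hB]
    exact ⟨C, D₀, fun D hD j hj hjB => by rw [tupleSum_fin_one]; exact hC D hD j hj hjB⟩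
  · exact stub_system k f hf hk2 A B hA hB

/-! ### Exactness of the split (sorry-free): the crux implies every stub's statement

So the crux is EQUIVALENT to `stub_linear ∧ stub_quadratic ∧ stub_higher ∧ stub_system` — the line loses
nothing, and each regime can be attacked (or refuted) separately. -/

/-- The crux implies the single-polynomial statement (all degrees at once): specialise to `k = 1`,
`f = ![g]`, and re-index. [folklore] -/
theorem single_of_muRootWeyl (h : Summit.Parity.BatemanHorn.Theses.LambertRoots.MuRootWeyl) :
    ∀ g : Polynomial ℤ, Literature.NumberTheory.Sieve.IsBatemanHornSystem ![g] →
    ∀ A B : ℝ, 0 < A → 0 < B → ∃ C : ℝ, ∃ D₀ : ℕ, ∀ D : ℕ, D₀ ≤ D → ∀ j : ℤ, j ≠ 0 →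
      (|j| : ℝ) ≤ Real.log D ^ B →
      ‖∑ d ∈ Finset.Icc 1 D, (((ArithmeticFunction.moebius d : ℝ) * Real.log d : ℝ) : ℂ) *
          Literature.NumberTheory.Sieve.polyRootWeylSum g d j‖ ≤ C * (D : ℝ) / Real.log D ^ A := by
  intro g hg A B hA hB
  obtain ⟨C, D₀, hC⟩ := h 1 ![g] hg A B hA hB
  refine ⟨C, D₀, fun D hD j hj hjB => ?_⟩
  have key := hC D hD j hj hjB
  rw [tupleSum_fin_one] at key
  exact key

/-- The crux implies the system statement (restriction to `k ≥ 2`). [folklore] -/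
theorem system_of_muRootWeyl (h : Summit.Parity.BatemanHorn.Theses.LambertRoots.MuRootWeyl) :
    ∀ (k : ℕ) (f : Fin k → Polynomial ℤ), Literature.NumberTheory.Sieve.IsBatemanHornSystem f → 2 ≤ k →
    ∀ A B : ℝ, 0 < A → 0 < B → ∃ C : ℝ, ∃ D₀ : ℕ, ∀ D : ℕ, D₀ ≤ D → ∀ j : ℤ, j ≠ 0 →
      (|j| : ℝ) ≤ Real.log D ^ B →
      ‖∑ d ∈ (Fintype.piFinset fun _ : Fin k => Finset.Icc 1 D).filter (fun d => Finset.univ.lcm d ≤ D),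
          ((∏ i, ((ArithmeticFunction.moebius (d i) : ℝ) * Real.log (d i)) : ℝ) : ℂ) *
          ∑ ν ∈ (Finset.range (Finset.univ.lcm d)).filter
              (fun ν : ℕ => ∀ i, ((d i : ℕ) : ℤ) ∣ (f i).eval (ν : ℤ)),
            Complex.exp (2 * Real.pi * Complex.I * ((j : ℂ) * (ν : ℂ) / ((Finset.univ.lcm d : ℕ) : ℂ)))‖
        ≤ C * (D : ℝ) / Real.log D ^ A :=
  fun k f hf _ => h k f hf

end Summit.Parity.BatemanHorn.Cruxes.MuRootWeyl.Birth
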